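import Literature.NumberTheory.Sieve.GoldbachLinnikRomanovClassCert
import HarnessLib

/-!
# Romanov's constant by the order-class method, part 2: blocks 8–15 and the assembly `romanovConst ≤ 1.944`

Topic `Literature/NumberTheory/Sieve`; sequel to `GoldbachLinnikRomanovClassCert.lean` (cell `pub-lg7`, seat 4).
**NOT A ROUTE TO GOLDBACH; `K = 7` is NOT claimed (print record `K = 8`); nothing in-house is cited as fact.**

The remaining eight kernel blocks of the order-class certificate, the block sums, the Abel-summed head bound, the far range from
`GoldbachLinnikRomanovConstBound` (`farV_le`, `TjR`, `A1Q`; here from `j = 12`), and the headline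
`romanovConst_le_1944 : romanovConst ≤ 1.944` (print `1.936 < R₀ < 1.94` [PintzRuzsa2003, (8.14)]; the 20-file certificate
`GoldbachLinnikRomanovCert*` of seat 2 gives the sharper `1.94` by an independent method).  `1.944` is below the tolerance `1.9545` of the
direct-route record `K = 8` (`GoldbachLinnikDirectCertifiedInputs.direct_eight_criterion`).

## References

* D. R. Heath-Brown, J.-C. Puchta, *Integers represented as a sum of primes and powers of two*, Asian J. Math. 6 (2002): §5 (41). [HeathbrownPuchta2002]
* J. Pintz, I. Z. Ruzsa, *On Linnik's approximation to Goldbach's problem, I*, Acta Arith. 109 (2003): (8.13)–(8.14). [PintzRuzsa2003]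
-/

open Finset

namespace Literature.NumberTheory.Sieve

namespace GoldbachLinnik

open SingularSeriesMean Literature.NumberTheory.Sieve.Romanov

namespace R0Cert

/-! ### §1 Kernel verifications, part 2 -/

set_option maxHeartbeats 40000000 in
/-- Kernel check of block `8` (`n ∈ [2048, 2304)`). [folklore] -/
theorem chunk_ok_8 : chunkGo certTree (bigF 17) 17 4096 (Wtab.getD 8 0) (if 8 = 0 then 255 else 256)
    (if 8 = 0 then 1 else 256 * 8) 0 = true := by
  decide +kernel
set_option maxHeartbeats 40000000 in
/-- Kernel check of block `9` (`n ∈ [2304, 2560)`). [folklore] -/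
theorem chunk_ok_9 : chunkGo certTree (bigF 17) 17 4096 (Wtab.getD 9 0) (if 9 = 0 then 255 else 256)
    (if 9 = 0 then 1 else 256 * 9) 0 = true := by
  decide +kernel
set_option maxHeartbeats 40000000 in
/-- Kernel check of block `10` (`n ∈ [2560, 2816)`). [folklore] -/
theorem chunk_ok_10 : chunkGo certTree (bigF 17) 17 4096 (Wtab.getD 10 0) (if 10 = 0 then 255 else 256)
    (if 10 = 0 then 1 else 256 * 10) 0 = true := by
  decide +kernel
set_option maxHeartbeats 40000000 in
/-- Kernel check of block `11` (`n ∈ [2816, 3072)`). [folklore] -/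
theorem chunk_ok_11 : chunkGo certTree (bigF 17) 17 4096 (Wtab.getD 11 0) (if 11 = 0 then 255 else 256)
    (if 11 = 0 then 1 else 256 * 11) 0 = true := by
  decide +kernel
set_option maxHeartbeats 40000000 in
/-- Kernel check of block `12` (`n ∈ [3072, 3328)`). [folklore] -/
theorem chunk_ok_12 : chunkGo certTree (bigF 17) 17 4096 (Wtab.getD 12 0) (if 12 = 0 then 255 else 256)
    (if 12 = 0 then 1 else 256 * 12) 0 = true := by
  decide +kernel
set_option maxHeartbeats 40000000 in
/-- Kernel check of block `13` (`n ∈ [3328, 3584)`). [folklore] -/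
theorem chunk_ok_13 : chunkGo certTree (bigF 17) 17 4096 (Wtab.getD 13 0) (if 13 = 0 then 255 else 256)
    (if 13 = 0 then 1 else 256 * 13) 0 = true := by
  decide +kernel
set_option maxHeartbeats 40000000 in
/-- Kernel check of block `14` (`n ∈ [3584, 3840)`). [folklore] -/
theorem chunk_ok_14 : chunkGo certTree (bigF 17) 17 4096 (Wtab.getD 14 0) (if 14 = 0 then 255 else 256)
    (if 14 = 0 then 1 else 256 * 14) 0 = true := by
  decide +kernel
set_option maxHeartbeats 40000000 in
/-- Kernel check of block `15` (`n ∈ [3840, 4096)`). [folklore] -/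
theorem chunk_ok_15 : chunkGo certTree (bigF 17) 17 4096 (Wtab.getD 15 0) (if 15 = 0 then 255 else 256)
    (if 15 = 0 then 1 else 256 * 15) 0 = true := by
  decide +kernel

/-- The sixteen block checks, uniformly indexed. [folklore] -/
theorem chunk_ok {i : ℕ} (hi : i < 16) : chunkGo certTree (bigF 17) 17 4096 (Wtab.getD i 0) (if i = 0 then 255 else 256)
    (if i = 0 then 1 else 256 * i) 0 = true := by
  interval_cases i
  · exact chunk_ok_0
  · exact chunk_ok_1
  · exact chunk_ok_2
  · exact chunk_ok_3
  · exact chunk_ok_4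
  · exact chunk_ok_5
  · exact chunk_ok_6
  · exact chunk_ok_7
  · exact chunk_ok_8
  · exact chunk_ok_9
  · exact chunk_ok_10
  · exact chunk_ok_11
  · exact chunk_ok_12
  · exact chunk_ok_13
  · exact chunk_ok_14
  · exact chunk_ok_15

/-- The final numerical inequality: `∑_i W_i + A₁ · T(12) ≤ 1.944`. [folklore] -/
theorem final_ineq : ((List.range 16).map fun i => Wtab.getD i 0).sum + A1Q * (536213 / 76800000) ≤ 1944 / 1000 := by
  decide +kernel

/-! ### §2 Assembly -/

/-- The certified value `u(n)` as a real number. [folklore] -/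
noncomputable def uR (n : ℕ) : ℝ := (((stepN certTree (bigF 17) 17 n).2 : ℚ) : ℝ)

/-- Every step `1 ≤ n < 4096` passes its checks. [folklore] -/
theorem steps_ok {n : ℕ} (h1 : 1 ≤ n) (h2 : n < 4096) : (stepN certTree (bigF 17) 17 n).1 = true := by
  have hi : n / 256 < 16 := by omega
  have h := (chunkGo_sound certTree (bigF 17) 17 4096 _ _ _ 0 (chunk_ok hi)).1
  by_cases h0 : n / 256 = 0
  · rw [h0] at h
    exact h n (by simp; omega) (by simp; omega)
  · refine h n ?_ ?_
    · rw [if_neg h0]; omega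
    · rw [if_neg h0, if_neg h0]; omega

/-- Block sums: `∑_{n ∈ [1, 256(m+1))} u(n)(1/n − 1/M) ≤ ∑_{i ≤ m} W_i` for `m < 16`. [folklore] -/
theorem blocks_le : ∀ m : ℕ, m < 16 →
    ∑ n ∈ Ico 1 (256 * (m + 1)), (stepN certTree (bigF 17) 17 n).2 * (1 / (n : ℚ) - 1 / (4096 : ℚ)) ≤
      ((List.range (m + 1)).map fun i => Wtab.getD i 0).sum
  | 0, _ => by
      have h := (chunkGo_sound certTree (bigF 17) 17 4096 _ _ _ 0 (chunk_ok (show 0 < 16 by norm_num))).2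
      simp only [if_true, zero_add] at h
      simpa using h
  | m + 1, hm => by
      have ih := blocks_le m (by omega)
      have h := (chunkGo_sound certTree (bigF 17) 17 4096 _ _ _ 0 (chunk_ok hm)).2
      rw [if_neg (by omega), if_neg (by omega), zero_add] at h
      rw [← Finset.sum_Ico_consecutive _ (show 1 ≤ 256 * (m + 1) by omega) (show 256 * (m + 1) ≤ 256 * (m + 1 + 1) by omega),
        List.range_succ, List.map_append, List.sum_append, List.map_singleton, List.sum_singleton]
      refine add_le_add ih ?_
      have e : 256 * (m + 1) + 256 = 256 * (m + 1 + 1) := by ring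
      rw [e] at h
      exact_mod_cast h

/-- The head sum: `∑_{n<4096} u(n)(1/n − 1/4096) ≤ ∑_i W_i`. [folklore] -/
theorem head_le : ∑ n ∈ Ico 1 4096, uR n * (1 / (n : ℝ) - 1 / (4096 : ℝ)) ≤
    ((((List.range 16).map fun i => Wtab.getD i 0).sum : ℚ) : ℝ) := by
  have h := blocks_le 15 (by norm_num)
  rw [show 256 * (15 + 1) = 4096 by norm_num] at h
  have h' : ((∑ n ∈ Ico 1 4096, (stepN certTree (bigF 17) 17 n).2 * (1 / (n : ℚ) - 1 / (4096 : ℚ)) : ℚ) : ℝ) ≤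
      ((((List.range 16).map fun i => Wtab.getD i 0).sum : ℚ) : ℝ) := by exact_mod_cast h
  refine le_of_eq_of_le ?_ h'
  rw [Rat.cast_sum]
  refine Finset.sum_congr rfl fun n _ => ?_
  rw [uR]
  push_cast
  ring

/-- The global majorant: cumulative certified values below `4096`, the far-range value `V(⌊log₂ x⌋)` beyond. [folklore] -/
noncomputable def Umaj4 (x : ℕ) : ℝ := if x < 4096 then ∑ n ∈ Icc 1 x, uR n else farV (Nat.log 2 x)

/-- `E_X(x) ≤ U(x)` for every `x ≥ 1` and every `X`. [folklore] -/
theorem sum_filter_le_Umaj4 (s : Finset ℕ) {x : ℕ} (hx1 : 1 ≤ x) :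
    ∑ t ∈ s with ordTwo t ≤ x, fq 1 t ≤ Umaj4 x := by
  by_cases hx : x < 4096
  · rw [Umaj4, if_pos hx]
    exact sum_filter_le_cum certTree_ok (by norm_num) (fun n hn hnx => steps_ok hn (by omega)) s
  · rw [Umaj4, if_neg hx]
    push Not at hx
    have h12 : 12 ≤ Nat.log 2 x := Nat.le_log_of_pow_le one_lt_two (by norm_num; omega)
    exact sum_filter_ordTwo_le_farV s (le_trans (by norm_num) h12) (Nat.lt_pow_succ_log_self one_lt_two x)

/-- `T(12) = 536213/76800000`. [folklore] -/
theorem TjR_twelve : TjR 12 = 536213 / 76800000 := by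
  rw [TjR]; norm_num

/-- Telescoping from `12`: `∑_{j=12}^{J} g(j)/2^{j+1} = T(12) − T(J+1)`. [folklore] -/
theorem sum_gfun12 : ∀ J, 12 ≤ J → ∑ j ∈ Icc 12 J, gfun j / 2 ^ (j + 1) = TjR 12 - TjR (J + 1) := by
  refine Nat.le_induction ?_ fun J hJ ih => ?_
  · rw [Finset.Icc_self, Finset.sum_singleton, TjR_sub]
  · rw [Finset.sum_Icc_succ_top (by omega), ih, ← TjR_sub]; ring

/-- Dyadic decomposition of `[2^12, 2^{J+1})`. [folklore] -/
theorem sum_Ico_dyadic12 (f : ℕ → ℝ) : ∀ J, 12 ≤ J →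
    ∑ x ∈ Ico (2 ^ 12) (2 ^ (J + 1)), f x = ∑ j ∈ Icc 12 J, ∑ x ∈ Ico (2 ^ j) (2 ^ (j + 1)), f x := by
  refine Nat.le_induction (by rw [Finset.Icc_self, Finset.sum_singleton]) fun J hJ ih => ?_
  rw [Finset.sum_Icc_succ_top (by omega), ← ih,
    Finset.sum_Ico_consecutive _ (Nat.pow_le_pow_right two_pos (by omega))
      (Nat.pow_le_pow_right two_pos (by omega))]

/-- **Uniform bound for the partial sums**: `∑_{t<X} f₁(t)/ξ(t) ≤ 1.944` for every `X`.
[cite: HeathbrownPuchta2002, §5 (41); PintzRuzsa2003, (8.14)] -/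
theorem sum_range_fq_div_ordTwo_le_1944 (X : ℕ) :
    ∑ t ∈ Finset.range X, fq 1 t / (ordTwo t : ℝ) ≤ 1.944 := by
  -- dyadic ceiling `X ≤ X' = 2^{J+1} − 1`, `J ≥ 12`
  obtain ⟨J, hJ12, hXlt⟩ : ∃ J, 12 ≤ J ∧ X < 2 ^ (J + 1) :=
    ⟨max 12 (Nat.log 2 X), le_max_left _ _,
      (Nat.lt_pow_succ_log_self one_lt_two X).trans_le (Nat.pow_le_pow_right two_pos (by omega))⟩
  have hX'1 : 2 ^ (J + 1) - 1 + 1 = 2 ^ (J + 1) := Nat.sub_add_cancel Nat.one_le_two_pow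
  have h8192 : 2 ^ 13 ≤ 2 ^ (J + 1) := Nat.pow_le_pow_right two_pos (by omega)
  have hJJ : 2 ^ J ≤ 2 ^ (J + 1) - 1 := by rw [pow_succ] at hX'1 ⊢; omega
  set X' := 2 ^ (J + 1) - 1 with hX'def
  have hXX' : X ≤ X' := by omega
  have h4096 : 4096 ≤ X' := by norm_num at h8192; omega
  have hnn : ∀ t, 0 ≤ fq 1 t / (ordTwo t : ℝ) := fun t => div_nonneg (fq_nonneg 1 t) (Nat.cast_nonneg _)
  have hmono : ∑ t ∈ Finset.range X, fq 1 t / (ordTwo t : ℝ) ≤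
      ∑ t ∈ Finset.range X', fq 1 t / (ordTwo t : ℝ) :=
    Finset.sum_le_sum_of_subset_of_nonneg (Finset.range_mono hXX') fun t _ _ => hnn t
  refine hmono.trans ?_
  have hmaj := sum_range_fq_div_ordTwo_le_of_majorant Umaj4 (X := X') (by omega)
    fun x hx => sum_filter_le_Umaj4 _ (Finset.mem_Icc.1 hx).1
  refine hmaj.trans ?_
  -- split `[1, X'] = [1, 4096) ∪ [2^12, 2^{J+1})`
  have hsplit : ∑ x ∈ Icc 1 X', Umaj4 x / ((x : ℝ) * (x + 1)) =
      ∑ x ∈ Ico 1 4096, Umaj4 x / ((x : ℝ) * (x + 1)) +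
        ∑ x ∈ Ico (2 ^ 12) (2 ^ (J + 1)), Umaj4 x / ((x : ℝ) * (x + 1)) := by
    have h1 : Icc 1 X' = Ico 1 4096 ∪ Ico (2 ^ 12) (2 ^ (J + 1)) := by
      ext x; simp only [Finset.mem_Icc, Finset.mem_union, Finset.mem_Ico]; omega
    rw [h1, Finset.sum_union]
    rw [Finset.disjoint_left]
    intro x h1 h2
    simp only [Finset.mem_Ico] at h1 h2
    omega
  -- head
  have hhead : ∑ x ∈ Ico 1 4096, Umaj4 x / ((x : ℝ) * (x + 1)) ≤
      ((((List.range 16).map fun i => Wtab.getD i 0).sum : ℚ) : ℝ) := by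
    have hU : ∀ x ∈ Ico 1 4096, Umaj4 x / ((x : ℝ) * (x + 1)) = (∑ n ∈ Icc 1 x, uR n) / ((x : ℝ) * (x + 1)) := by
      intro x hx
      rw [Umaj4, if_pos (Finset.mem_Ico.1 hx).2]
    rw [Finset.sum_congr rfl hU, abel_cum uR (by norm_num)]
    exact_mod_cast head_le
  -- far blocks
  have hblock : ∀ j ∈ Icc 12 J, ∑ x ∈ Ico (2 ^ j) (2 ^ (j + 1)), Umaj4 x / ((x : ℝ) * (x + 1)) =
      farV j / 2 ^ (j + 1) := by
    intro j hj
    have hj12 : 12 ≤ j := (Finset.mem_Icc.1 hj).1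
    have h2j : 2 ^ 12 ≤ 2 ^ j := Nat.pow_le_pow_right two_pos hj12
    have hU : ∀ x ∈ Ico (2 ^ j) (2 ^ (j + 1)), Umaj4 x / ((x : ℝ) * (x + 1)) =
        farV j * (1 / ((x : ℝ) * (x + 1))) := by
      intro x hx
      have hx' := Finset.mem_Ico.1 hx
      have : ¬ x < 4096 := by norm_num at h2j; omega
      rw [Umaj4, if_neg this, Nat.log_eq_of_pow_le_of_lt_pow hx'.1 hx'.2]
      ring
    rw [Finset.sum_congr rfl hU, ← Finset.mul_sum, sum_Ico_block]
    ring
  have hlast : Umaj4 X' / ((X' : ℝ) + 1) = farV J / 2 ^ (J + 1) := by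
    have : ¬ X' < 4096 := by omega
    rw [Umaj4, if_neg this, Nat.log_eq_of_pow_le_of_lt_pow hJJ (by omega)]
    have hc : (X' : ℝ) + 1 = (2 : ℝ) ^ (J + 1) := by
      rw [hX'def, Nat.cast_sub Nat.one_le_two_pow]; push_cast; ring
    rw [hc]
  have hfar : ∑ x ∈ Ico (2 ^ 12) (2 ^ (J + 1)), Umaj4 x / ((x : ℝ) * (x + 1)) + Umaj4 X' / ((X' : ℝ) + 1) ≤
      ((A1Q : ℚ) : ℝ) * TjR 12 := by
    rw [sum_Ico_dyadic12 _ J hJ12, Finset.sum_congr rfl hblock, hlast]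
    have hJ8 : 8 ≤ J := le_trans (by norm_num) hJ12
    have hA0 : 0 ≤ ((A1Q : ℚ) : ℝ) := by
      have := farV_le hJ8
      have hV : 0 ≤ farV J := by
        have := sum_filter_ordTwo_le_farV (∅ : Finset ℕ) (x := 2 ^ (J + 1) - 1) hJ8 (by omega)
        simpa using this
      have hg : 0 < gfun J := by
        rw [gfun]
        have : (17 : ℝ) ≤ ((2 * J + 1 : ℕ) : ℝ) := by exact_mod_cast (show 17 ≤ 2 * J + 1 by omega)
        exact mul_pos (by linarith) (by nlinarith)
      nlinarith
    have h1 : ∑ j ∈ Icc 12 J, farV j / 2 ^ (j + 1) ≤ ((A1Q : ℚ) : ℝ) * ∑ j ∈ Icc 12 J, gfun j / 2 ^ (j + 1) := by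
      rw [Finset.mul_sum]
      refine Finset.sum_le_sum fun j hj => ?_
      rw [mul_div_assoc']
      exact div_le_div_of_nonneg_right (farV_le (le_trans (by norm_num) (Finset.mem_Icc.1 hj).1)) (by positivity)
    have h2 : farV J / 2 ^ (J + 1) ≤ ((A1Q : ℚ) : ℝ) * (gfun J / 2 ^ (J + 1)) := by
      rw [mul_div_assoc']
      exact div_le_div_of_nonneg_right (farV_le hJ8) (by positivity)
    have h3 := gfun_div_le_TjR J
    calc _ ≤ ((A1Q : ℚ) : ℝ) * ∑ j ∈ Icc 12 J, gfun j / 2 ^ (j + 1) + ((A1Q : ℚ) : ℝ) * (gfun J / 2 ^ (J + 1)) :=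
          add_le_add h1 h2
      _ = ((A1Q : ℚ) : ℝ) * (TjR 12 - TjR (J + 1) + gfun J / 2 ^ (J + 1)) := by rw [sum_gfun12 J hJ12]; ring
      _ ≤ ((A1Q : ℚ) : ℝ) * TjR 12 := mul_le_mul_of_nonneg_left (by linarith) hA0
  have hfin : ((((List.range 16).map fun i => Wtab.getD i 0).sum : ℚ) : ℝ) + ((A1Q : ℚ) : ℝ) * TjR 12 ≤ 1.944 := by
    rw [TjR_twelve]
    have h := final_ineq
    have h' : (((((List.range 16).map fun i => Wtab.getD i 0).sum + A1Q * (536213 / 76800000) : ℚ)) : ℝ) ≤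
        ((1944 / 1000 : ℚ) : ℝ) := Rat.cast_le.2 h
    simp only [Rat.cast_add, Rat.cast_mul, Rat.cast_div, Rat.cast_ofNat] at h'
    linarith
  calc ∑ x ∈ Icc 1 X', Umaj4 x / ((x : ℝ) * (x + 1)) + Umaj4 X' / ((X' : ℝ) + 1)
      = ∑ x ∈ Ico 1 4096, Umaj4 x / ((x : ℝ) * (x + 1)) +
          (∑ x ∈ Ico (2 ^ 12) (2 ^ (J + 1)), Umaj4 x / ((x : ℝ) * (x + 1)) + Umaj4 X' / ((X' : ℝ) + 1)) := by
        rw [hsplit, add_assoc]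
    _ ≤ ((((List.range 16).map fun i => Wtab.getD i 0).sum : ℚ) : ℝ) + ((A1Q : ℚ) : ℝ) * TjR 12 := add_le_add hhead hfar
    _ ≤ 1.944 := hfin

end R0Cert

/-- **Kernel-certified bound for Romanov's constant by the order-class method**: `R₀ = ∑_t f₁(t)/ord_t 2 ≤ 1.944`
(print: `1.936 < R₀ < 1.94` [PintzRuzsa2003, (8.14)], Khalfalah–Pintz Cor. 1 "by calculations"; the cell's two-engine numerics
`R₀ ∈ [1.93667, 1.93670]`).  Order classes `n < 2^12` treated exactly over all primes `< 2^17` of order `n` (completeness by the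
cofactor–gcd check), the primes beyond by the counting inflation `(1 + 2^{-17})^ν`, the range `x ≥ 2^12` by the Mertens-window
majorant of `GoldbachLinnikRomanovConstBound`.  Standard axioms; every numerical input re-verified by `decide +kernel`.
[cite: HeathbrownPuchta2002, §5 (41); PintzRuzsa2003, (8.13)–(8.14)] -/
theorem romanovConst_le_1944 : romanovConst ≤ 1.944 :=
  Real.tsum_le_of_sum_range_le (fun t => div_nonneg (fq_nonneg 1 t) (Nat.cast_nonneg _))
    R0Cert.sum_range_fq_div_ordTwo_le_1944


end GoldbachLinnik

end Literature.NumberTheory.Sieve
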